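import Mathlib
import Summits.NavierStokesRegularity.NavierStokesRegularity.Theses.FrozenSignCascade
import HarnessLib

/-!
# Route FrozenSignCascade · crux `EnvelopeBound` (stmt-NavierStokesRegularity-1549): time
  derivatives of Fourier-side mild solutions and of their weighted quadratic functionals

Support file for the crux item stmt-NavierStokesRegularity-1549 (`EnvelopeBound`, route
`FrozenSignCascade`, line `registered`, lead c3); lands `--supports` that item. It supplies the
calculus layer of Leray's energy/enstrophy mechanism for GENERAL Fourier-side mild solutions
`V` (`FourierNS.IsFourierMild c K₀ t₀ t₁ V`), which the line so far never used (every earlier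
estimate of the line was a magnitude bound on the Duhamel formula):

* `hasDerivWithinAt_slice` / `hasDerivAt_slice`: **mild ⇒ differential** — at every frequency,
  `∂ₜ V(t,ξ) = -c‖ξ‖² V(t,ξ) − N(V(t),V(t))(ξ)` within `[t₀,t₁]` (and as an honest derivative at
  interior times), from the two-time Duhamel formula by the product rule and the fundamental
  theorem of calculus (the computation of `PicardHyp.hasDerivWithinAt_limit`, done for the class
  instead of the Picard limit);
* `continuous_weightedSq`: for a continuous weight `w` of polynomial growth, the functional
  `t ↦ ∫ w(ξ) ∑ₗ ‖V(t,ξ)ₗ‖² dξ` is continuous on `ℝ` (dominated convergence: joint continuity and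
  decay of every order uniformly in time);
* `hasDerivAt_normSq_apply`: the pointwise derivative of the component energy density,
  `d/dt ‖V(t,ξ)ₗ‖² = -2c‖ξ‖²‖V(t,ξ)ₗ‖² − 2 Re(conj(V(t,ξ)ₗ) N(V,V)(t,ξ)ₗ)` — the differentiation
  of `∫ w ∑ₗ ‖Vₗ‖²` under the integral sign is the companion file `…EnvelopeBoundWeightedDeriv`.

References: J. Leray, Acta Math. 63 (1934) §§19–22; P. G. Lemarié-Rieusset, *The Navier–Stokes
problem in the 21st century* (2016), §7.3, §8.5 (mild ⇔ differential formulation).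
-/

noncomputable section

set_option linter.dupNamespace false -- nested layout Summit.<S>.<Sub>, Sub = S (D-0017)

open Set MeasureTheory Filter Topology Real
open scoped ComplexConjugate InnerProductSpace
open Literature.Analysis.FluidPDE Literature.Analysis.FluidPDE.FourierNS

namespace Summit.NavierStokesRegularity.NavierStokesRegularity.Theorems.EnvelopeBound.Leray

variable {ι : Type*} [Fintype ι] [DecidableEq ι]
variable {c t₀ t₁ : ℝ} {K₀ : ℕ} {V : ℝ → EuclideanSpace ℝ ι → ι → ℂ}

/-! ### Mild ⇒ differential -/

/-- **Mild ⇒ differential (within the interval).** A Fourier-side mild solution on `[t₀,t₁]`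
satisfies, at every frequency `ξ` and every `t ∈ [t₀,t₁]`,
`∂ₜ V(t,ξ) = -c‖ξ‖² V(t,ξ) − N(V(t),V(t))(ξ)` as a derivative within `[t₀,t₁]`: write the
Duhamel formula from `t₀` as `V(t) = e^{-βt}(e^{βt₀} V(t₀)) − e^{-βt} ∫_{t₀}^t e^{βr} N(r) dr`,
`β = c‖ξ‖²`, and differentiate (product rule, fundamental theorem of calculus). -/
theorem hasDerivWithinAt_slice (h : IsFourierMild c K₀ t₀ t₁ V) (ξ : EuclideanSpace ℝ ι)
    {t : ℝ} (ht : t ∈ Icc t₀ t₁) :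
    HasDerivWithinAt (fun s => V s ξ)
      (-(c * ‖ξ‖ ^ 2) • V t ξ - nonlin (V t) (V t) ξ) (Icc t₀ t₁) t := by
  set β := c * ‖ξ‖ ^ 2 with hβ
  set N : ℝ → ι → ℂ := fun s => nonlin (V s) (V s) ξ with hN
  have hNc : Continuous N := h.continuous_nonlin_time ξ
  -- `G s = ∫_{t₀}ˢ e^{βσ} N(σ) dσ` and its derivative
  set G : ℝ → ι → ℂ := fun s => ∫ σ in t₀..s, Real.exp (β * σ) • N σ with hG
  have hGi : Continuous fun σ => Real.exp (β * σ) • N σ :=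
    (Real.continuous_exp.comp (continuous_const.mul continuous_id)).smul hNc
  have hG' : ∀ s, HasDerivAt G (Real.exp (β * s) • N s) s := fun s =>
    (hGi.integral_hasStrictDerivAt t₀ s).hasDerivAt
  -- the heat factor and its derivative
  have hheat : ∀ s, heat c ξ s = Real.exp (-β * s) := fun s => by simp [heat, hβ]
  have hE' : ∀ s, HasDerivAt (fun s => Real.exp (-β * s)) (-β * Real.exp (-β * s)) s :=
    fun s => by
    have := ((hasDerivAt_id s).const_mul (-β)).exp
    simpa [mul_comm] using this
  -- `F s = e^{-βs} a₀ − e^{-βs} G s`, `a₀ = e^{βt₀} V(t₀)`, is the Duhamel formula from `t₀`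
  set a₀ : ι → ℂ := Real.exp (β * t₀) • V t₀ ξ with ha₀
  set F : ℝ → ι → ℂ := fun s => Real.exp (-β * s) • a₀ - Real.exp (-β * s) • G s with hF
  have hF' : ∀ s, HasDerivAt F (-β • F s - N s) s := by
    intro s
    have h1 : HasDerivAt (fun s => Real.exp (-β * s) • a₀) ((-β * Real.exp (-β * s)) • a₀) s :=
      (hE' s).smul_const _
    have h2 : HasDerivAt (fun s => Real.exp (-β * s) • G s)
        (Real.exp (-β * s) • (Real.exp (β * s) • N s) + (-β * Real.exp (-β * s)) • G s) s :=
      (hE' s).smul (hG' s)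
    have h3 := h1.sub h2
    have hone : Real.exp (-β * s) * Real.exp (β * s) = 1 := by
      rw [← Real.exp_add]; simp
    have heq : (-β * Real.exp (-β * s)) • a₀ -
        (Real.exp (-β * s) • (Real.exp (β * s) • N s) + (-β * Real.exp (-β * s)) • G s) =
        -β • F s - N s := by
      simp only [hF, smul_sub, smul_smul, hone, one_smul]
      module
    rw [heq] at h3
    exact h3
  -- on `[t₀, t₁]`, `V s ξ = F s`
  have hVF : ∀ s ∈ Icc t₀ t₁, V s ξ = F s := by
    intro s hs
    have hD := h.duhamel le_rfl hs.1 hs.2 ξ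
    rw [hD, hheat]
    have hint : (∫ σ in t₀..s, heat c ξ (s - σ) • nonlin (V σ) (V σ) ξ) =
        Real.exp (-β * s) • G s := by
      simp only [hG]
      rw [← intervalIntegral.integral_smul]
      refine intervalIntegral.integral_congr fun σ _ => ?_
      change heat c ξ (s - σ) • N σ = Real.exp (-β * s) • (Real.exp (β * σ) • N σ)
      rw [hheat, smul_smul, ← Real.exp_add]
      congr 1; ring_nf
    rw [hint]
    simp only [hF, ha₀, smul_smul, ← Real.exp_add]
    congr 2; ring_nf
  have key := (hF' t).hasDerivWithinAt (s := Icc t₀ t₁)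
  rw [← hVF t ht] at key
  exact key.congr (fun s hs => hVF s hs) (hVF t ht)

/-- **Mild ⇒ differential (interior times).** At `t ∈ (t₀,t₁)` the slice `s ↦ V(s,ξ)` has the
honest derivative `-c‖ξ‖² V(t,ξ) − N(V(t),V(t))(ξ)`. -/
theorem hasDerivAt_slice (h : IsFourierMild c K₀ t₀ t₁ V) (ξ : EuclideanSpace ℝ ι)
    {t : ℝ} (ht : t ∈ Ioo t₀ t₁) :
    HasDerivAt (fun s => V s ξ) (-(c * ‖ξ‖ ^ 2) • V t ξ - nonlin (V t) (V t) ξ) t :=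
  (hasDerivWithinAt_slice h ξ (Ioo_subset_Icc_self ht)).hasDerivAt (Icc_mem_nhds ht.1 ht.2)

/-- Componentwise form of `hasDerivAt_slice`. -/
theorem hasDerivAt_slice_apply (h : IsFourierMild c K₀ t₀ t₁ V) (ξ : EuclideanSpace ℝ ι)
    {t : ℝ} (ht : t ∈ Ioo t₀ t₁) (l : ι) :
    HasDerivAt (fun s => V s ξ l)
      (-((c * ‖ξ‖ ^ 2 : ℝ) : ℂ) * V t ξ l - nonlin (V t) (V t) ξ l) t := by
  have := hasDerivAt_pi.1 (hasDerivAt_slice h ξ ht) l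
  simpa [Complex.real_smul] using this

/-! ### The pointwise derivative of `‖V(t,ξ)ₗ‖²` -/

/-- The pointwise derivative of the component energy density:
`d/dt ‖V(t,ξ)ₗ‖² = -2c‖ξ‖² ‖V(t,ξ)ₗ‖² − 2 Re(conj(V(t,ξ)ₗ) N(V,V)(t,ξ)ₗ)` at interior times. -/
theorem hasDerivAt_normSq_apply (h : IsFourierMild c K₀ t₀ t₁ V) (ξ : EuclideanSpace ℝ ι)
    {t : ℝ} (ht : t ∈ Ioo t₀ t₁) (l : ι) :
    HasDerivAt (fun s => ‖V s ξ l‖ ^ 2)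
      (-(2 * c) * (‖ξ‖ ^ 2 * ‖V t ξ l‖ ^ 2) -
        2 * (conj (V t ξ l) * nonlin (V t) (V t) ξ l).re) t := by
  -- `d/dt ‖z(t)‖² = 2⟪z, z'⟫_ℝ = 2 Re(conj(z) z')` (known one-variable calculus, cf.
  -- `LefschetzBase.hasDerivAt_norm_sq_comp`), applied to the slice derivative
  have hz := hasDerivAt_slice_apply h ξ ht l
  have h1 : HasDerivAt (fun s => ‖V s ξ l‖ ^ 2)
      (2 * (conj (V t ξ l) * (-((c * ‖ξ‖ ^ 2 : ℝ) : ℂ) * V t ξ l - nonlin (V t) (V t) ξ l)).re) t := by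
    have h2 := hz.norm_sq
    rw [Complex.inner] at h2
    convert h2 using 3
    ring
  convert h1 using 1
  rw [mul_sub, Complex.sub_re, mul_sub]
  congr 1
  have : conj (V t ξ l) * (-((c * ‖ξ‖ ^ 2 : ℝ) : ℂ) * V t ξ l) =
      -((c * ‖ξ‖ ^ 2 : ℝ) : ℂ) * (conj (V t ξ l) * V t ξ l) := by ring
  rw [this, Complex.conj_mul' (V t ξ l)]
  rw [show -((c * ‖ξ‖ ^ 2 : ℝ) : ℂ) * ((‖V t ξ l‖ : ℂ) ^ 2) =
      ((-(c * ‖ξ‖ ^ 2) * ‖V t ξ l‖ ^ 2 : ℝ) : ℂ) by push_cast; ring, Complex.ofReal_re]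
  ring

/-! ### Weighted quadratic functionals: continuity -/

omit [DecidableEq ι] in
/-- Weight bookkeeping: `(1+‖ξ‖)^m · ((1+‖ξ‖)^{m+K})⁻¹ = ((1+‖ξ‖)^K)⁻¹`. -/
theorem weight_pow_mul_inv_pow_add (ξ : EuclideanSpace ℝ ι) (m K : ℕ) :
    (1 + ‖ξ‖) ^ m * ((1 + ‖ξ‖) ^ (m + K))⁻¹ = ((1 + ‖ξ‖) ^ K)⁻¹ := by
  have hw : 0 < 1 + ‖ξ‖ := by positivity
  rw [pow_add, mul_inv, ← mul_assoc, mul_inv_cancel₀ (pow_ne_zero _ hw.ne'), one_mul]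

omit [DecidableEq ι] in
/-- The component sum of squares against the sup norm: `∑ₗ ‖z l‖² ≤ card ι · ‖z‖²`. -/
theorem sum_norm_sq_le_card_mul (z : ι → ℂ) : ∑ l, ‖z l‖ ^ 2 ≤ Fintype.card ι * ‖z‖ ^ 2 := by
  calc ∑ l, ‖z l‖ ^ 2 ≤ ∑ _l : ι, ‖z‖ ^ 2 :=
        Finset.sum_le_sum fun l _ => pow_le_pow_left₀ (norm_nonneg _) (norm_le_pi_norm z l) 2
    _ = Fintype.card ι * ‖z‖ ^ 2 := by simp [Finset.sum_const, Finset.card_univ]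

omit [DecidableEq ι] in
/-- **Pointwise domination of the weighted density.** If `|w(ξ)| ≤ (1+‖ξ‖)^m` and `V(r)` has
decay of order `m + K₀` with constant `A` for all `r`, then
`|w(ξ) ∑ₗ ‖V(r,ξ)ₗ‖²| ≤ card ι · A² · (1+‖ξ‖)^{-K₀}`. -/
theorem norm_weightedSq_le {w : EuclideanSpace ℝ ι → ℝ} {m : ℕ}
    (hwb : ∀ ξ, |w ξ| ≤ (1 + ‖ξ‖) ^ m) {A : ℝ} (hA : ∀ r, HasDecay (m + K₀) A (V r))
    (r : ℝ) (ξ : EuclideanSpace ℝ ι) :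
    ‖w ξ * ∑ l, ‖V r ξ l‖ ^ 2‖ ≤ Fintype.card ι * A ^ 2 * ((1 + ‖ξ‖) ^ K₀)⁻¹ := by
  have hA0 : 0 ≤ A := (hA r).nonneg
  have hw : 0 < 1 + ‖ξ‖ := by positivity
  have hV1 : ‖V r ξ‖ ≤ A * ((1 + ‖ξ‖) ^ (m + K₀))⁻¹ := hA r ξ
  have hV2 : ‖V r ξ‖ ≤ A := (hA r).norm_le ξ
  rw [norm_mul, Real.norm_eq_abs, Real.norm_of_nonneg (Finset.sum_nonneg fun l _ => sq_nonneg _)]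
  calc |w ξ| * ∑ l, ‖V r ξ l‖ ^ 2 ≤ (1 + ‖ξ‖) ^ m * (Fintype.card ι * ‖V r ξ‖ ^ 2) :=
        mul_le_mul (hwb ξ) (sum_norm_sq_le_card_mul _) (Finset.sum_nonneg fun l _ => sq_nonneg _)
          (by positivity)
    _ = Fintype.card ι * ((1 + ‖ξ‖) ^ m * (‖V r ξ‖ * ‖V r ξ‖)) := by ring
    _ ≤ Fintype.card ι * ((1 + ‖ξ‖) ^ m * (A * ((1 + ‖ξ‖) ^ (m + K₀))⁻¹ * A)) := by
        have := mul_le_mul hV1 hV2 (norm_nonneg _) (by positivity)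
        gcongr
    _ = Fintype.card ι * A ^ 2 * ((1 + ‖ξ‖) ^ m * ((1 + ‖ξ‖) ^ (m + K₀))⁻¹) := by ring
    _ = Fintype.card ι * A ^ 2 * ((1 + ‖ξ‖) ^ K₀)⁻¹ := by rw [weight_pow_mul_inv_pow_add]

/-- **Continuity of weighted quadratic functionals.** For a Fourier-side mild solution `V` and a
continuous weight `w` of polynomial growth, `t ↦ ∫ w(ξ) ∑ₗ ‖V(t,ξ)ₗ‖² dξ` is continuous on `ℝ`
(dominated convergence: the slices are jointly continuous and decay to every order uniformly in
time). The cases `w = 1` (energy) and `w = ‖ξ‖²` (enstrophy) are the ones used below. -/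
theorem continuous_weightedSq (h : IsFourierMild c K₀ t₀ t₁ V) {w : EuclideanSpace ℝ ι → ℝ}
    (hw : Continuous w) {m : ℕ} (hwb : ∀ ξ, |w ξ| ≤ (1 + ‖ξ‖) ^ m) :
    Continuous fun t => ∫ ξ, w ξ * ∑ l, ‖V t ξ l‖ ^ 2 := by
  obtain ⟨A, hA⟩ := h.decay (m + K₀)
  have hmeas : ∀ t, AEStronglyMeasurable (fun ξ => w ξ * ∑ l, ‖V t ξ l‖ ^ 2) volume :=
    fun t => (hw.mul (continuous_finsetSum _ fun l _ =>
      ((continuous_apply l).comp (h.continuous_slice t)).norm.pow 2)).aestronglyMeasurable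
  refine continuous_of_dominated (bound := fun ξ => Fintype.card ι * A ^ 2 * ((1 + ‖ξ‖) ^ K₀)⁻¹)
    hmeas (fun t => Eventually.of_forall fun ξ => norm_weightedSq_le hwb hA t ξ)
    ((integrable_inv_one_add_norm_pow (finrank_lt_of_card_lt h.hK₀)).const_mul _)
    (Eventually.of_forall fun ξ => ?_)
  exact continuous_const.mul (continuous_finsetSum _ fun l _ =>
    ((continuous_apply l).comp (h.continuous_time ξ)).norm.pow 2)

/-- Continuity of the Fourier energy `t ↦ ∫ ∑ₗ ‖V(t,ξ)ₗ‖² dξ`. -/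
theorem continuous_energy (h : IsFourierMild c K₀ t₀ t₁ V) :
    Continuous fun t => ∫ ξ, ∑ l, ‖V t ξ l‖ ^ 2 := by
  have := continuous_weightedSq h (w := fun _ => (1 : ℝ)) continuous_const (m := 0)
    (fun ξ => by simp)
  simpa using this

/-- Continuity of the Fourier enstrophy `t ↦ ∫ ‖ξ‖² ∑ₗ ‖V(t,ξ)ₗ‖² dξ`. -/
theorem continuous_enstrophy (h : IsFourierMild c K₀ t₀ t₁ V) :
    Continuous fun t => ∫ ξ, ‖ξ‖ ^ 2 * ∑ l, ‖V t ξ l‖ ^ 2 :=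
  continuous_weightedSq h (continuous_norm.pow 2) (m := 2) fun ξ => by
    rw [abs_of_nonneg (sq_nonneg _)]
    exact pow_le_pow_left₀ (norm_nonneg _) (by linarith [norm_nonneg ξ]) 2

/-! ### Registered form (dimension three, all binders explicit) -/

/-- **Mild ⇒ differential on `ℝ³` (registered support statement of the crux item).** For every
Fourier-side mild solution `V` of the transformed Navier–Stokes system on `[t₀,t₁]`, every
frequency `ξ` and every interior time `t`, the slice `s ↦ V(s,ξ)` is differentiable at `t` with
derivative `-c‖ξ‖² V(t,ξ) − N(V(t),V(t))(ξ)`. -/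
theorem hasDerivAt_slice_fin3 :
    ∀ (c : ℝ) (K₀ : ℕ) (t₀ t₁ : ℝ) (V : ℝ → EuclideanSpace ℝ (Fin 3) → Fin 3 → ℂ),
      Literature.Analysis.FluidPDE.FourierNS.IsFourierMild c K₀ t₀ t₁ V →
      ∀ ξ : EuclideanSpace ℝ (Fin 3), ∀ t ∈ Set.Ioo t₀ t₁,
        HasDerivAt (fun s => V s ξ)
          (-(c * ‖ξ‖ ^ 2) • V t ξ - Literature.Analysis.FluidPDE.FourierNS.nonlin (V t) (V t) ξ) t :=
  fun _ _ _ _ _ h ξ _ ht => hasDerivAt_slice h ξ ht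

/-- **Continuity of the Fourier enstrophy on `ℝ³` (registered support statement).** -/
theorem continuous_enstrophy_fin3 :
    ∀ (c : ℝ) (K₀ : ℕ) (t₀ t₁ : ℝ) (V : ℝ → EuclideanSpace ℝ (Fin 3) → Fin 3 → ℂ),
      Literature.Analysis.FluidPDE.FourierNS.IsFourierMild c K₀ t₀ t₁ V →
      Continuous fun t => ∫ ξ, ‖ξ‖ ^ 2 * ∑ l, ‖V t ξ l‖ ^ 2 :=
  fun _ _ _ _ _ h => continuous_enstrophy h

end Summit.NavierStokesRegularity.NavierStokesRegularity.Theorems.EnvelopeBound.Leray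

end
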